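import Summits.Ventures.HodgeRepro.TwistedQuadIINegModel

/-!
# Route-2's Theorem T, sub-case (ii), `ε = −`, for EVERY `k ≥ 3` — one kernel theorem

Blind re-derivation cell `pub-hodge-repro`, seat `p1` (gen 12).  On the model `(ℤ/2k × ℤ/2) ⋊ ℤ/2` of
`TwistedQuadIICore` with `s = −1` (`u v u⁻¹ = c v⁻¹`) the uniform family found by `tfamilyII.py` (verified
`k = 3..12` by enumeration, proved here for every `k ≥ 3`): with `ℓ := k + (k mod 2)` and
`f₀(n, g) := [vⁿ uᵍ ∈ Φ]`, `f₀(n, 0) = [n < ℓ] ⊕ [n odd]`, `f₀(n, 1) = [1 ≤ n ≤ ℓ]`, and `vⁿ c uᵍ ∈ Φ ↔ vⁿ uᵍ ∉ Φ`.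
The three local conditions (CM, SumTwo on the rectangle `1, u, v, vu`, no conjugate pair) are proved symbolically
(coordinates of `TwistedQuadIICore`, `ℤ/2k` value arithmetic, case splits, `omega`; the 16 pairs separated by the
points `1, v, v²`), and `exists_twistedRectQuad_ii_of_model` transports to every finite `(G, c)`:
`exists_twistedRectQuad_ii_neg`.
-/

set_option autoImplicit false

open Finset Multiplicative
open scoped Pointwise

namespace HodgeRepro.TwistedQuadIIGen

open HodgeRepro.CosetQuad

variable (k : ℕ) [NeZero k]

/-! ### The pattern -/

/-- `ℓ = k + (k mod 2)`, the even number nearest `k` from above. -/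
def ell : ℕ := k + k % 2

/-- `f₀(n, 0) = [n < ℓ] ⊕ [n odd]`. -/
def patA (n : ℕ) : Prop := (n < ell k ∧ n % 2 = 0) ∨ (ell k ≤ n ∧ n % 2 = 1)

/-- `f₀(n, 1) = [1 ≤ n ≤ ℓ]`. -/
def patB (n : ℕ) : Prop := 1 ≤ n ∧ n ≤ ell k

/-- The predicate `(patA k)` is decidable. -/
instance : DecidablePred (patA k) := fun n => by unfold patA; infer_instance
/-- The predicate `(patB k)` is decidable. -/
instance : DecidablePred (patB k) := fun n => by unfold patB; infer_instance

/-- `f₀(n, g)`. -/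
def patF (n : ℕ) (g : ZMod 2) : Prop := if g = 0 then patA k n else patB k n

/-- The predicate `(fun n => patF k n g)` is decidable. -/
instance (g : ZMod 2) : DecidablePred (fun n => patF k n g) := fun n => by unfold patF; infer_instance

/-- The pattern on the model: `vⁿ cᵉ uᵍ ∈ Φ ↔ (e = 0 ↔ f₀(n, g))`. -/
def patN (p : HN k) : Prop := (toAdd p.left.2 = 0 ↔ patF k (toAdd p.left.1).val (toAdd p.right))

/-- The predicate `(patN k)` is decidable. -/
instance : DecidablePred (patN k) := fun p => by unfold patN; infer_instance

/-- The CM type of the model. -/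
def ΦN : Finset (HN k) := univ.filter (patN k)

/-- Membership in coordinates. -/
theorem mem_mkN (a : ZMod (2 * k)) (e g : ZMod 2) : mkN k a e g ∈ ΦN k ↔ (e = 0 ↔ patF k a.val g) := by
  simp only [ΦN, mem_filter, mem_univ, true_and]
  exact Iff.rfl

/-- Membership on the `e = 0` layer. -/
theorem mem_mkN_zero (a : ZMod (2 * k)) (g : ZMod 2) : mkN k a 0 g ∈ ΦN k ↔ patF k a.val g := by
  rw [mem_mkN]; exact ⟨fun h => h.mp rfl, fun h => ⟨fun _ => h, fun _ => rfl⟩⟩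

/-- Membership on the `e = 1` layer. -/
theorem mem_mkN_one (a : ZMod (2 * k)) (g : ZMod 2) : mkN k a 1 g ∈ ΦN k ↔ ¬ patF k a.val g := by
  rw [mem_mkN]
  have h10 : ¬ ((1 : ZMod 2) = 0) := by decide
  exact ⟨fun h hp => h10 (h.mpr hp), fun h => ⟨fun h1 => absurd h1 h10, fun hp => absurd hp h⟩⟩

omit [NeZero k] in
/-- `patF` at `g = 0`. -/
theorem patF_zero (n : ℕ) : patF k n 0 = patA k n := if_pos rfl

omit [NeZero k] in
/-- `patF` at `g = 1`. -/
theorem patF_one (n : ℕ) : patF k n 1 = patB k n := if_neg (by decide)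

/-! ### The three local conditions -/

/-- CM: `p c ∈ Φ ↔ p ∉ Φ`. -/
theorem cm_neg (p : HN k) : p * cII (2 * k) (hm2 k) (sN k) (sN_sq k) (sN_odd k) ∈ ΦN k ↔ ¬ p ∈ ΦN k := by
  obtain ⟨⟨l, m⟩, r⟩ := p
  obtain ⟨a, rfl⟩ := ofAdd.surjective l
  obtain ⟨e, rfl⟩ := ofAdd.surjective m
  obtain ⟨g, rfl⟩ := ofAdd.surjective r
  show mkN k a e g * cII (2 * k) (hm2 k) (sN k) (sN_sq k) (sN_odd k) ∈ ΦN k ↔ ¬ mkN k a e g ∈ ΦN k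
  rw [mkN_mul_c]
  rcases (show ∀ y : ZMod 2, y = 0 ∨ y = 1 by decide) e with rfl | rfl
  · rw [zero_add, mem_mkN_one, mem_mkN_zero]
  · rw [two_zmod_two', mem_mkN_zero, mem_mkN_one, not_not]

/-- The four neighbour memberships of `mkN a 0 0`, as predicates on the value of `a`. -/
def Mk (i : Fin 4) (a : ZMod (2 * k)) : Prop :=
  match i with
  | 0 => patA k a.val
  | 1 => patB k a.val
  | 2 => patA k (a - 1).val
  | 3 => ¬ patB k (a + 1).val

/-- The neighbour memberships of a `⟨v⟩`-point. -/
theorem mem_nbr (a : ZMod (2 * k)) (i : Fin 4) :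
    mkN k a 0 0 * (rectTII (2 * k) (hm2 k) (sN k) (sN_sq k) (sN_odd k) i)⁻¹ ∈ ΦN k ↔ Mk k i a := by
  obtain ⟨n0, n1, n2, n3⟩ := nbrs_zero k a 0
  have hfin : ∀ x : Fin 4, x = 0 ∨ x = 1 ∨ x = 2 ∨ x = 3 := by decide
  rcases hfin i with rfl | rfl | rfl | rfl
  · rw [n0, mem_mkN_zero, patF_zero]; exact Iff.rfl
  · rw [n1, mem_mkN_zero, patF_one]; exact Iff.rfl
  · rw [n2, mem_mkN_zero, patF_zero]; exact Iff.rfl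
  · rw [n3, zero_add, mem_mkN_one, patF_one]; exact Iff.rfl

/-- SumTwo: exactly two of the four neighbours of every point lie in `Φ`. -/
theorem sumTwo_neg (hk : 3 ≤ k) (p : HN k) :
    (univ.filter fun i : Fin 4 => p * (rectTII (2 * k) (hm2 k) (sN k) (sN_sq k) (sN_odd k) i)⁻¹ ∈ ΦN k).card = 2 := by
  obtain ⟨⟨l, m⟩, r⟩ := p
  obtain ⟨a, rfl⟩ := ofAdd.surjective l
  obtain ⟨e, rfl⟩ := ofAdd.surjective m
  obtain ⟨g, rfl⟩ := ofAdd.surjective r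
  have ep : (⟨(ofAdd a, ofAdd e), ofAdd g⟩ : HN k) = mkN k a e g := rfl
  rw [ep, Finset.card_filter, Fin.sum_univ_four]
  have hv : a.val < 2 * k := ZMod.val_lt a
  have hA1 := val_add_one k a
  have hS1 := val_sub_one k a
  rcases (show ∀ y : ZMod 2, y = 0 ∨ y = 1 by decide) g with rfl | rfl <;>
    rcases (show ∀ y : ZMod 2, y = 0 ∨ y = 1 by decide) e with rfl | rfl
  · obtain ⟨n0, n1, n2, n3⟩ := nbrs_zero k a 0
    simp only [n0, n1, n2, n3, zero_add, mem_mkN_zero, mem_mkN_one, patF_zero, patF_one, patA, patB, ell, hA1, hS1]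
    split_ifs <;> omega
  · obtain ⟨n0, n1, n2, n3⟩ := nbrs_zero k a 1
    simp only [n0, n1, n2, n3, two_zmod_two', mem_mkN_zero, mem_mkN_one, patF_zero, patF_one, patA, patB, ell, hA1,
      hS1]
    split_ifs <;> omega
  · obtain ⟨n0, n1, n2, n3⟩ := nbrs_one k a 0
    simp only [n0, n1, n2, n3, zero_add, mem_mkN_zero, mem_mkN_one, patF_zero, patF_one, patA, patB, ell, hA1, hS1]
    split_ifs <;> omega
  · obtain ⟨n0, n1, n2, n3⟩ := nbrs_one k a 1
    simp only [n0, n1, n2, n3, two_zmod_two', mem_mkN_zero, mem_mkN_one, patF_zero, patF_one, patA, patB, ell, hA1,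
      hS1]
    split_ifs <;> omega

/-- A `⟨v⟩`-point `a` at which the memberships `Φ t_j` and `Φ t_i` AGREE refutes the conjugate pair `(i, j)`. -/
theorem sep_of (a : ZMod (2 * k)) (i j : Fin 4) (h : Mk k j a ↔ Mk k i a) :
    ¬ ∀ q : HN k, (q * (rectTII (2 * k) (hm2 k) (sN k) (sN_sq k) (sN_odd k) j)⁻¹ ∈ ΦN k ↔
      q * (cII (2 * k) (hm2 k) (sN k) (sN_sq k) (sN_odd k) *
        (rectTII (2 * k) (hm2 k) (sN k) (sN_sq k) (sN_odd k) i)⁻¹) ∈ ΦN k) := by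
  intro hall
  have hc : ∀ q : HN k, q * (cII (2 * k) (hm2 k) (sN k) (sN_sq k) (sN_odd k) *
      (rectTII (2 * k) (hm2 k) (sN k) (sN_sq k) (sN_odd k) i)⁻¹) =
      (q * (rectTII (2 * k) (hm2 k) (sN k) (sN_sq k) (sN_odd k) i)⁻¹) *
        cII (2 * k) (hm2 k) (sN k) (sN_sq k) (sN_odd k) := by
    intro q
    obtain ⟨⟨l, m⟩, r⟩ := q
    obtain ⟨a, rfl⟩ := ofAdd.surjective l
    obtain ⟨e, rfl⟩ := ofAdd.surjective m
    obtain ⟨g, rfl⟩ := ofAdd.surjective r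
    have ep : (⟨(ofAdd a, ofAdd e), ofAdd g⟩ : HN k) = mkN k a e g := rfl
    rw [ep, ← mul_assoc, mkN_mul_c]
    have hfin : ∀ x : Fin 4, x = 0 ∨ x = 1 ∨ x = 2 ∨ x = 3 := by decide
    rcases (show ∀ y : ZMod 2, y = 0 ∨ y = 1 by decide) g with rfl | rfl
    · obtain ⟨n0, n1, n2, n3⟩ := nbrs_zero k a e
      obtain ⟨m0, m1, m2, m3⟩ := nbrs_zero k a (e + 1)
      rcases hfin i with rfl | rfl | rfl | rfl
      · rw [m0, n0, mkN_mul_c]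
      · rw [m1, n1, mkN_mul_c]
      · rw [m2, n2, mkN_mul_c]
      · rw [m3, n3, mkN_mul_c, add_right_comm]
    · obtain ⟨n0, n1, n2, n3⟩ := nbrs_one k a e
      obtain ⟨m0, m1, m2, m3⟩ := nbrs_one k a (e + 1)
      rcases hfin i with rfl | rfl | rfl | rfl
      · rw [m0, n0, mkN_mul_c]
      · rw [m1, n1, mkN_mul_c]
      · rw [m2, n2, mkN_mul_c, add_right_comm]
      · rw [m3, n3, mkN_mul_c]
  have := hall (mkN k a 0 0)
  rw [hc, cm_neg, mem_nbr, mem_nbr] at this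
  by_cases hi : Mk k i a
  · exact (this.mp (h.mpr hi)) hi
  · exact hi (h.mp (this.mpr hi))

/-- The values of the witness points `0, 1, 2` and their neighbours. -/
theorem witness_vals (hk : 3 ≤ k) :
    ((0 : ZMod (2 * k)).val = 0 ∧ ((0 : ZMod (2 * k)) - 1).val = 2 * k - 1 ∧ ((0 : ZMod (2 * k)) + 1).val = 1) ∧
    (((1 : ℕ) : ZMod (2 * k)).val = 1 ∧ (((1 : ℕ) : ZMod (2 * k)) - 1).val = 0 ∧
      (((1 : ℕ) : ZMod (2 * k)) + 1).val = 2) ∧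
    (((2 : ℕ) : ZMod (2 * k)).val = 2 ∧ (((2 : ℕ) : ZMod (2 * k)) - 1).val = 1 ∧
      (((2 : ℕ) : ZMod (2 * k)) + 1).val = 3) := by
  have h0 : (0 : ZMod (2 * k)).val = 0 := ZMod.val_zero
  have h1 : ((1 : ℕ) : ZMod (2 * k)).val = 1 := ZMod.val_natCast_of_lt (by omega)
  have h2 : ((2 : ℕ) : ZMod (2 * k)).val = 2 := ZMod.val_natCast_of_lt (by omega)
  refine ⟨⟨h0, ?_, ?_⟩, ⟨h1, ?_, ?_⟩, ⟨h2, ?_, ?_⟩⟩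
  · rw [val_sub_one, h0, if_pos rfl]
  · rw [val_add_one, h0, if_pos (by omega)]
  · rw [val_sub_one, h1, if_neg (by omega)]
  · rw [val_add_one, h1, if_pos (by omega)]
  · rw [val_sub_one, h2, if_neg (by omega)]
  · rw [val_add_one, h2, if_pos (by omega)]

/-- No conjugate pair: for every `(i, j)` one of the points `1, v, v²` has equal memberships `Φ t_j`, `Φ t_i`. -/
theorem noConj_neg (hk : 3 ≤ k) (i j : Fin 4) :
    ¬ ∀ q : HN k, (q * (rectTII (2 * k) (hm2 k) (sN k) (sN_sq k) (sN_odd k) j)⁻¹ ∈ ΦN k ↔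
      q * (cII (2 * k) (hm2 k) (sN k) (sN_sq k) (sN_odd k) *
        (rectTII (2 * k) (hm2 k) (sN k) (sN_sq k) (sN_odd k) i)⁻¹) ∈ ΦN k) := by
  obtain ⟨⟨a0, b0, c0⟩, ⟨a1, b1, c1⟩, ⟨a2, b2, c2⟩⟩ := witness_vals k hk
  have he : ell k = k + k % 2 := rfl
  have hfin : ∀ x : Fin 4, x = 0 ∨ x = 1 ∨ x = 2 ∨ x = 3 := by decide
  -- the memberships at the three witness points: 0 ↦ (T, F, T, F), 1 ↦ (F, T, T, F), 2 ↦ (T, T, F, F)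
  have w0 : Mk k 0 0 ∧ ¬ Mk k 1 0 ∧ Mk k 2 0 ∧ ¬ Mk k 3 0 := by
    simp only [Mk, patA, patB, he, a0, b0, c0, and_true, not_not]; omega
  have w1 : ¬ Mk k 0 ((1 : ℕ) : ZMod (2 * k)) ∧ Mk k 1 ((1 : ℕ) : ZMod (2 * k)) ∧
      Mk k 2 ((1 : ℕ) : ZMod (2 * k)) ∧ ¬ Mk k 3 ((1 : ℕ) : ZMod (2 * k)) := by
    simp only [Mk, patA, patB, he, a1, b1, c1, and_true, not_not]; omega
  have w2 : Mk k 0 ((2 : ℕ) : ZMod (2 * k)) ∧ Mk k 1 ((2 : ℕ) : ZMod (2 * k)) ∧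
      ¬ Mk k 2 ((2 : ℕ) : ZMod (2 * k)) ∧ ¬ Mk k 3 ((2 : ℕ) : ZMod (2 * k)) := by
    simp only [Mk, patA, patB, he, a2, b2, c2, and_true, not_not]; omega
  obtain ⟨p0, p1, p2, p3⟩ := w0
  obtain ⟨q0, q1, q2, q3⟩ := w1
  obtain ⟨r0, r1, r2, r3⟩ := w2
  rcases hfin i with rfl | rfl | rfl | rfl <;> rcases hfin j with rfl | rfl | rfl | rfl
  · exact sep_of k 0 0 0 Iff.rfl
  · exact sep_of k _ 0 1 (iff_of_true r1 r0)
  · exact sep_of k 0 0 2 (iff_of_true p2 p0)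
  · exact sep_of k _ 0 3 (iff_of_false q3 q0)
  · exact sep_of k _ 1 0 (iff_of_true r0 r1)
  · exact sep_of k 0 1 1 Iff.rfl
  · exact sep_of k _ 1 2 (iff_of_true q2 q1)
  · exact sep_of k 0 1 3 (iff_of_false p3 p1)
  · exact sep_of k 0 2 0 (iff_of_true p0 p2)
  · exact sep_of k _ 2 1 (iff_of_true q1 q2)
  · exact sep_of k 0 2 2 Iff.rfl
  · exact sep_of k _ 2 3 (iff_of_false r3 r2)
  · exact sep_of k _ 3 0 (iff_of_false q0 q3)
  · exact sep_of k 0 3 1 (iff_of_false p1 p3)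
  · exact sep_of k _ 3 2 (iff_of_false r2 r3)
  · exact sep_of k 0 3 3 Iff.rfl

/-! ### The theorem -/

/-- **Theorem T (ii), `ε = −`, for EVERY `k ≥ 3` (route-2 §9.39; kernel existence).**  For every finite `(G, c)`,
`v` of order `2k` with `c ∉ ⟨v⟩` and an involution `u ∉ ⟨v, c⟩` with `u v u⁻¹ = c v⁻¹`: some CM type has the twisted
rectangle `Φ, Φu, Φv, Φ(vu)` `SumTwo` without a conjugate pair. -/
theorem exists_twistedRectQuad_ii_neg {G : Type*} [Group G] [Fintype G] [DecidableEq G] (hk : 3 ≤ k) {c : G}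
    (hc : IsComplexConj c) (v u : G) (hv : orderOf v = 2 * k) (hu : u ^ 2 = 1) (huv : u * v * u⁻¹ = c * v⁻¹)
    (hcv : c ∉ Subgroup.zpowers v) (hunot : u ∉ Subgroup.closure ({v, c} : Set G)) :
    ∃ Φ : Finset G, IsCMType c Φ ∧ SumTwo (fun i => rmul Φ (![1, u, v, v * u] i)) ∧
      ∀ i j : Fin 4, rmul Φ (![1, u, v, v * u] j) ≠ c • rmul Φ (![1, u, v, v * u] i) := by
  have hvm : v ^ (2 * k) = 1 := by rw [← hv]; exact pow_orderOf_eq_one v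
  have hinv : v ^ (sN k).val = v⁻¹ := by
    rw [sN_val]
    exact eq_inv_of_mul_eq_one_left (by rw [← pow_succ, show 2 * k - 1 + 1 = 2 * k by omega]; exact hvm)
  exact exists_twistedRectQuad_ii_of_model (2 * k) (hm2 k) (sN k) (sN_sq k) (sN_odd k) (by omega) hc v u hv hu
    (by rw [hinv]; exact huv) hcv hunot (ΦN k)
    (fun p => (decide_eq_decide.mpr (cm_neg k p)).trans decide_not)
    (fun p => by simp only [decide_eq_true_eq]; exact sumTwo_neg k hk p)
    (fun i j h => noConj_neg k hk i j (fun p => by simpa only [decide_eq_true_eq] using h p))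

end HodgeRepro.TwistedQuadIIGen
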